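import Summits.QuantumFields.QCD.Theses.HeatSlicedQuarks
import Summits.QuantumFields.QCD.Theorems.HeatSlicedQuarksTracedQuadraticParametrixInteriorTracedAssemblyAux
import Summits.QuantumFields.QCD.Theorems.HeatSlicedQuarksInterleavedHeatSliceFlowStubGlobalCombGauge

/-!
# Stub `stub_interiorTracedAssembly` of line `Sketch` (crux `TracedQuadraticParametrix`, item stmt-QuantumFields-17985)

**Interior traced assembly** (M/L glue): `DerivativeColumnIdentification → FirstOrderTracedPairing →
TracedSplittingIdentity → InteriorTracedBound`, written out.  On a torus of side `L ≥ A r²/ε`, under global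
`(ε/r²)²`-smallness of the plaquette deficits and `ε ≤ ε₀`, the colour–spin TRACE of the on-diagonal heat-kernel
correction `Φ_U(t) = Σ_{a,α} Re [e^{-tH_U} − e^{-tH_1}]((x,a,α),(x,a,α))`, `H = D_Wᴴ D_W`, is second order:
`|Φ_U(t)| ≤ C (ε/r²)²` for `1 ≤ t ≤ r²`.

## Proof

Put `δ = ε/r² ∈ (0,1]`, `t = 2s`.
1. *Comb gauge.*  The landed `stub_globalCombGauge` (needs `A₀/δ ≤ L`, granted by `A = max A₀ 1`) gives `g` with
   `3 − Re tr W(z,μ) ≤ C_A (d(x,z)+1)² δ²` for `W = U^g`; `W` has the plaquette deficits of `U` and the colour trace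
   `Σ_a e^{-tH}((x,a,α),(x,a,α))` is gauge invariant (8871's `stub_gaugeCovariance`), so `Φ_U = Φ_W`.
2. *Splitting.*  Hypothesis `TracedSplittingIdentity` with `A = D_W(W)`, `B = D_W(1)` at each of the twelve indices
   `p = (x,a,α)`, summed: `Φ_W(2s) = Σ_p ‖Δ(s)e_p‖₂² − 2 Re ∫₀ˢ F(τ) dτ`,
   `F(τ) = Σ_p (K_1(2s−τ)(H_W − H_1)K_W(τ))(p,p)`, `Δ = K_W − K_1` (continuity of the integrands:
   `continuousOn_sandwich_entry`, so `Σ_p ∫ = ∫ Σ_p`).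
3. *Square term.*  The landed linear column law (`stub_columnIdentification` fed with `stub_hoppingWeightedBounds`,
   `stub_freeColumnProfile`, `stub_freeWeightedMoments`): `‖Δ(s)e_p‖₂ ≤ C_c δ`, so `Σ_p ‖Δ(s)e_p‖₂² ≤ 12 C_c² δ²`.
4. *The `τ`-integrand.*  Split `K_W(τ) = K_1(τ) + Δ(τ)`.  The `K_1(τ)` part is hypothesis `FirstOrderTracedPairing` at
   `(σ,τ) = (2s−τ,τ)`: `≤ C_B δ²/√((1+2s−τ)(1+τ)) ≤ C_B δ²/(√(1+s)√(1+τ))`.  The `Δ(τ)` part, per index: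
   `(K_1(σ)(H_W − H_1)Δ(τ))(p,p) = ⟨EᴴD_1K_1(σ)e_p, Δ(τ)e_p⟩ + ⟨EK_1(σ)e_p, D_WΔ(τ)e_p⟩` (`heat_vertex_split`,
   `H_W − H_1 = D_1ᴴE + EᴴD_W`, `E = D_W − D_1`), and Cauchy–Schwarz (`second_order_entry_bound`) with
   `‖EᴴD_1K_1(σ)e_p‖₂ ≤ δA₁/(1+σ)`, `‖EK_1(σ)e_p‖₂ ≤ δA₁/√(1+σ)` (`hopping_column_bounds`), `‖Δ(τ)e_p‖₂ ≤ C_cδ`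
   (step 3) and `‖D_WΔ(τ)e_p‖₂ ≤ C_Dδ/√(1+τ)` (hypothesis `DerivativeColumnIdentification`); with `σ = 2s−τ ≥ s`:
   `‖F(τ)‖ ≤ P/√(1+τ) + Q`, `P = δ²(C_B + 12A₁C_D)/√(1+s)`, `Q = 12δ²A₁C_c/(1+s)`.
5. *Integrate* (`norm_integral_le_of_inv_sqrt_bound`): `|Re ∫₀ˢ F| ≤ 2P√(1+s) + Qs ≤ 2δ²(C_B + 12A₁C_D) + 12δ²A₁C_c`.
   Total: `|Φ_U(t)| ≤ (12C_c² + 2(2(C_B + 12A₁C_D) + 12A₁C_c)) δ²`.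
-/

noncomputable section

namespace Summit.QuantumFields.QCD.Cruxes.TracedQuadraticParametrix.Sketch

open Literature.MathematicalPhysics.QuantumLattice Literature.MathematicalPhysics.QuantumFieldTheory
  Literature.Probability.LatticeModels
open Summit.QuantumFields.QCD.Theses.HeatSlicedQuarks
open Summit.QuantumFields.QCD.Theorems.SmallFieldUltracontractivity.Negative
open Summit.QuantumFields.QCD.Cruxes.SmallFieldUltracontractivity.PointCentredAxialParabolic
open Summit.QuantumFields.QCD.Cruxes.InterleavedHeatSliceFlow.Sketch
open MeasureTheory intervalIntegral
open scoped Matrix ComplexConjugate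

set_option maxHeartbeats 1600000 in
/-- **Stub `stub_interiorTracedAssembly`** (M/L glue): `DerivativeColumnIdentification → FirstOrderTracedPairing →
TracedSplittingIdentity → InteriorTracedBound`, all written out (see the module docstring for the proof). -/
theorem stub_interiorTracedAssembly :
    (∀ C_A : ℝ, 0 ≤ C_A → ∃ ε₀ : ℝ, 0 < ε₀ ∧ ∃ C : ℝ, ∀ (L : ℕ) [NeZero L]
      (W : GaugeConfig 4 L (SU3)) (m : ℝ), m ∈ Set.Icc (-(1 / 2 : ℝ)) 1 →
      ∀ (r : ℕ), 1 ≤ r → r ≤ L → ∀ (ε : ℝ), 0 < ε → ε ≤ ε₀ →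
      (∀ (y : TorusSite 4 L) (μ ν : Fin 4),
        3 - ((fundamentalRep (Fin 3)) (plaquetteHolonomy W y μ ν)).trace.re ≤ (ε / (r : ℝ) ^ 2) ^ 2) →
      ∀ (x : TorusSite 4 L),
      (∀ (z : TorusSite 4 L) (μ : Fin 4),
        3 - ((fundamentalRep (Fin 3)) (W (z, μ))).trace.re ≤
          C_A * ((torusDist x z : ℝ) + 1) ^ 2 * (ε / (r : ℝ) ^ 2) ^ 2) →
      ∀ (s : ℝ), 0 ≤ s → 2 * s ≤ (r : ℝ) ^ 2 → ∀ (a : Fin 3) (α : Fin 4),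
        Real.sqrt (∑ q, ‖(wilsonDirac (fundamentalRep (Fin 3)) W m 1 *
            (NormedSpace.exp (-(s : ℂ) • ((wilsonDirac (fundamentalRep (Fin 3)) W m 1)ᴴ *
                wilsonDirac (fundamentalRep (Fin 3)) W m 1)) -
              NormedSpace.exp (-(s : ℂ) •
                ((wilsonDirac (fundamentalRep (Fin 3))
                    (freeCfg L) m 1)ᴴ *
                  wilsonDirac (fundamentalRep (Fin 3))
                    (freeCfg L) m 1)))) q (x, a, α)‖ ^ 2) ≤
          C * (ε / (r : ℝ) ^ 2) / Real.sqrt (1 + s)) →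
    (∀ C_A : ℝ, 0 ≤ C_A → ∃ C : ℝ, ∀ (L : ℕ) [NeZero L]
      (W : GaugeConfig 4 L (SU3)) (m : ℝ), m ∈ Set.Icc (-(1 / 2 : ℝ)) 1 →
      ∀ (x : TorusSite 4 L) (δ : ℝ), 0 ≤ δ →
      (∀ (z : TorusSite 4 L) (μ : Fin 4),
        3 - ((fundamentalRep (Fin 3)) (W (z, μ))).trace.re ≤ C_A * ((torusDist x z : ℝ) + 1) ^ 2 * δ ^ 2) →
      ∀ (σ τ : ℝ), 0 ≤ σ → σ ≤ (L : ℝ) ^ 2 → 0 ≤ τ → τ ≤ (L : ℝ) ^ 2 →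
        ‖∑ a : Fin 3, ∑ α : Fin 4,
            (NormedSpace.exp (-(σ : ℂ) •
                ((wilsonDirac (fundamentalRep (Fin 3))
                    (freeCfg L) m 1)ᴴ *
                  wilsonDirac (fundamentalRep (Fin 3))
                    (freeCfg L) m 1)) *
              ((wilsonDirac (fundamentalRep (Fin 3)) W m 1)ᴴ * wilsonDirac (fundamentalRep (Fin 3)) W m 1 -
                (wilsonDirac (fundamentalRep (Fin 3))
                    (freeCfg L) m 1)ᴴ *
                  wilsonDirac (fundamentalRep (Fin 3))
                    (freeCfg L) m 1) *
              NormedSpace.exp (-(τ : ℂ) •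
                ((wilsonDirac (fundamentalRep (Fin 3))
                    (freeCfg L) m 1)ᴴ *
                  wilsonDirac (fundamentalRep (Fin 3))
                    (freeCfg L) m 1)))
              (x, a, α) (x, a, α)‖ ≤
          C * δ ^ 2 / Real.sqrt ((1 + σ) * (1 + τ))) →
    (∀ (ι : Type) [Fintype ι] [DecidableEq ι] (A B : Matrix ι ι ℂ) (s : ℝ), 0 ≤ s → ∀ p : ι,
      ((NormedSpace.exp (-((2 * s : ℝ) : ℂ) • (Aᴴ * A))) p p).re -
          ((NormedSpace.exp (-((2 * s : ℝ) : ℂ) • (Bᴴ * B))) p p).re =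
        (∑ q, ‖(NormedSpace.exp (-(s : ℂ) • (Aᴴ * A)) - NormedSpace.exp (-(s : ℂ) • (Bᴴ * B))) q p‖ ^ 2) -
          2 * (∫ τ in (0 : ℝ)..s, (NormedSpace.exp (-((2 * s - τ : ℝ) : ℂ) • (Bᴴ * B)) * (Aᴴ * A - Bᴴ * B) *
                NormedSpace.exp (-(τ : ℂ) • (Aᴴ * A))) p p).re) →
    ∃ ε₀ : ℝ, 0 < ε₀ ∧ ∃ A C : ℝ, ∀ (L : ℕ) [NeZero L]
      (U : GaugeConfig 4 L (SU3)) (m : ℝ), m ∈ Set.Icc (-(1 / 2 : ℝ)) 1 →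
      ∀ (r : ℕ), 1 ≤ r → r ≤ L → ∀ (ε : ℝ), 0 < ε → ε ≤ ε₀ →
      (∀ (y : TorusSite 4 L) (μ ν : Fin 4),
        3 - ((fundamentalRep (Fin 3)) (plaquetteHolonomy U y μ ν)).trace.re ≤ (ε / (r : ℝ) ^ 2) ^ 2) →
      A * (r : ℝ) ^ 2 / ε ≤ (L : ℝ) →
      ∀ (t : ℝ), 1 ≤ t → t ≤ (r : ℝ) ^ 2 → ∀ (x : TorusSite 4 L),
        |(∑ a : Fin 3, ∑ α : Fin 4, ((NormedSpace.exp (-(t : ℂ) •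
              ((wilsonDirac (fundamentalRep (Fin 3)) U m 1)ᴴ * wilsonDirac (fundamentalRep (Fin 3)) U m 1)))
              (x, a, α) (x, a, α)).re) -
          (∑ a : Fin 3, ∑ α : Fin 4, ((NormedSpace.exp (-(t : ℂ) •
              ((wilsonDirac (fundamentalRep (Fin 3))
                  (freeCfg L) m 1)ᴴ *
                wilsonDirac (fundamentalRep (Fin 3))
                  (freeCfg L) m 1)))
              (x, a, α) (x, a, α)).re)| ≤
          C * (ε / (r : ℝ) ^ 2) ^ 2 := by
  intro hDer hFirst hSplit
  obtain ⟨C_A, A₀, hCA, hg⟩ := stub_globalCombGauge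
  obtain ⟨ε₁, hε₁, C_c, hc⟩ :=
    stub_columnIdentification stub_hoppingWeightedBounds stub_freeColumnProfile stub_freeWeightedMoments C_A hCA
  obtain ⟨ε₂, hε₂, C_D, hDc⟩ := hDer C_A hCA
  obtain ⟨C_B, hB⟩ := hFirst C_A hCA
  obtain ⟨A₁, hA₁0, hE⟩ := hopping_column_bounds hCA
  -- nonnegative versions of the constants
  set C_c' : ℝ := max C_c 0 with hCc'
  set C_D' : ℝ := max C_D 0 with hCD'
  set C_B' : ℝ := max C_B 0 with hCB'
  have hCc'0 : 0 ≤ C_c' := le_max_right _ _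
  have hCD'0 : 0 ≤ C_D' := le_max_right _ _
  have hCB'0 : 0 ≤ C_B' := le_max_right _ _
  refine ⟨min (min ε₁ ε₂) 1, lt_min (lt_min hε₁ hε₂) one_pos, max A₀ 1,
    12 * C_c' ^ 2 + 2 * (2 * (C_B' + 12 * A₁ * C_D') + 12 * A₁ * C_c'), ?_⟩
  intro L _ U m hm r hr hrL ε hε hεle hsmall hbig t ht htr x
  obtain ⟨s, rfl⟩ : ∃ s, t = 2 * s := ⟨t / 2, by ring⟩
  -- scales
  have hr1 : (1 : ℝ) ≤ (r : ℝ) := by exact_mod_cast hr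
  have hr2 : (0 : ℝ) < (r : ℝ) ^ 2 := by positivity
  have hrL' : (r : ℝ) ≤ (L : ℝ) := by exact_mod_cast hrL
  have hL2 : (r : ℝ) ^ 2 ≤ (L : ℝ) ^ 2 := pow_le_pow_left₀ (by linarith) hrL' 2
  have hs0 : 0 ≤ s := by linarith
  have hs1 : (0 : ℝ) < 1 + s := by linarith
  have hε1 : ε ≤ 1 := hεle.trans (min_le_right _ _)
  have hεε₁ : ε ≤ ε₁ := hεle.trans ((min_le_left _ _).trans (min_le_left _ _))
  have hεε₂ : ε ≤ ε₂ := hεle.trans ((min_le_left _ _).trans (min_le_right _ _))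
  set δ : ℝ := ε / (r : ℝ) ^ 2 with hδ
  have hδ0 : 0 < δ := div_pos hε hr2
  have hδ1 : δ ≤ 1 := by
    rw [hδ, div_le_one hr2]; nlinarith
  have hL : A₀ / δ ≤ (L : ℝ) := by
    refine le_trans ?_ hbig
    rw [hδ, div_div_eq_mul_div]
    exact div_le_div_of_nonneg_right (mul_le_mul_of_nonneg_right (le_max_left _ _) hr2.le) hε.le
  /- 1. the global comb gauge `W = U^g` centred at `x`; plaquettes and the colour–spin trace are invariant -/
  obtain ⟨g, hprof⟩ := hg L U x δ hδ0 hδ1 hL (fun y μ ν => by rw [hδ]; exact hsmall y μ ν)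
  set W : GaugeConfig 4 L SU3 := gaugeTransform g U with hW
  have hsmallW : ∀ (y : TorusSite 4 L) (μ ν : Fin 4),
      3 - ((fundamentalRep (Fin 3)) (plaquetteHolonomy W y μ ν)).trace.re ≤ (ε / (r : ℝ) ^ 2) ^ 2 := by
    intro y μ ν
    rw [hW, (stub_gaugeCovariance L U g m s y).2 μ ν]
    exact hsmall y μ ν
  have hprof' : ∀ (z : TorusSite 4 L) (μ : Fin 4), 3 - ((fundamentalRep (Fin 3)) (W (z, μ))).trace.re ≤
      C_A * ((torusDist x z : ℝ) + 1) ^ 2 * (ε / (r : ℝ) ^ 2) ^ 2 := fun z μ => by rw [← hδ]; exact hprof z μ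
  set D : Matrix (TorusSite 4 L × Fin 3 × Fin 4) (TorusSite 4 L × Fin 3 × Fin 4) ℂ :=
    wilsonDirac (fundamentalRep (Fin 3)) W m 1 with hD
  set D₁ : Matrix (TorusSite 4 L × Fin 3 × Fin 4) (TorusSite 4 L × Fin 3 × Fin 4) ℂ :=
    wilsonDirac (fundamentalRep (Fin 3)) (freeCfg L) m 1 with hD₁
  let K : ℝ → Matrix (TorusSite 4 L × Fin 3 × Fin 4) (TorusSite 4 L × Fin 3 × Fin 4) ℂ := fun σ =>
    NormedSpace.exp (-(σ : ℂ) • (Dᴴ * D))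
  let K₁ : ℝ → Matrix (TorusSite 4 L × Fin 3 × Fin 4) (TorusSite 4 L × Fin 3 × Fin 4) ℂ := fun σ =>
    NormedSpace.exp (-(σ : ℂ) • (D₁ᴴ * D₁))
  have hinv : (∑ a : Fin 3, ∑ α : Fin 4, ((NormedSpace.exp (-((2 * s : ℝ) : ℂ) •
      ((wilsonDirac (fundamentalRep (Fin 3)) U m 1)ᴴ * wilsonDirac (fundamentalRep (Fin 3)) U m 1)))
      (x, a, α) (x, a, α)).re) = ∑ a : Fin 3, ∑ α : Fin 4, ((K (2 * s)) (x, a, α) (x, a, α)).re := by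
    have hα : ∀ α : Fin 4, ∑ a : Fin 3, ((NormedSpace.exp (-((2 * s : ℝ) : ℂ) •
        ((wilsonDirac (fundamentalRep (Fin 3)) U m 1)ᴴ * wilsonDirac (fundamentalRep (Fin 3)) U m 1)))
        (x, a, α) (x, a, α)).re = ∑ a : Fin 3, ((K (2 * s)) (x, a, α) (x, a, α)).re := by
      intro α
      rw [← Complex.re_sum, ← Complex.re_sum, ← (stub_gaugeCovariance L U g m (2 * s) x).1 α]
    rw [Finset.sum_comm]
    conv_rhs => rw [Finset.sum_comm]
    exact Finset.sum_congr rfl fun α _ => hα α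
  rw [hinv]
  /- 2. the splitting identity at the twelve indices `p = (x,a,α)`, `t = 2s` -/
  let f : Fin 3 → Fin 4 → ℝ → ℂ := fun a α τ =>
    (K₁ (2 * s - τ) * (Dᴴ * D - D₁ᴴ * D₁) * K τ) (x, a, α) (x, a, α)
  have hsplit : ∀ (a : Fin 3) (α : Fin 4),
      ((K (2 * s)) (x, a, α) (x, a, α)).re - ((K₁ (2 * s)) (x, a, α) (x, a, α)).re =
        (∑ q, ‖(K s - K₁ s) q (x, a, α)‖ ^ 2) - 2 * (∫ τ in (0:ℝ)..s, f a α τ).re :=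
    fun a α => hSplit _ D D₁ s hs0 (x, a, α)
  have hint : ∀ (a : Fin 3) (α : Fin 4), IntervalIntegrable (f a α) volume 0 s := fun a α =>
    (continuousOn_sandwich_entry (D₁ᴴ * D₁) (Dᴴ * D) (2 * s) (Set.Icc 0 s) (x, a, α)
      (x, a, α)).intervalIntegrable_of_Icc hs0
  have hexch : ∑ a : Fin 3, ∑ α : Fin 4, (∫ τ in (0:ℝ)..s, f a α τ).re =
      (∫ τ in (0:ℝ)..s, ∑ a : Fin 3, ∑ α : Fin 4, f a α τ).re := by
    have hIa : ∀ a : Fin 3, IntervalIntegrable (fun τ => ∑ α : Fin 4, f a α τ) volume 0 s := by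
      intro a
      have h := IntervalIntegrable.sum Finset.univ fun α (_ : α ∈ (Finset.univ : Finset (Fin 4))) => hint a α
      rwa [Finset.sum_fn] at h
    rw [intervalIntegral.integral_finsetSum fun a _ => hIa a, Complex.re_sum]
    refine Finset.sum_congr rfl fun a _ => ?_
    rw [intervalIntegral.integral_finsetSum fun α _ => hint a α, Complex.re_sum]
  /- 3. the square term: the landed linear column law -/
  have hsq : ∑ a : Fin 3, ∑ α : Fin 4, (∑ q, ‖(K s - K₁ s) q (x, a, α)‖ ^ 2) ≤ 12 * (C_c' * δ) ^ 2 := by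
    have hone : ∀ (a : Fin 3) (α : Fin 4), (∑ q, ‖(K s - K₁ s) q (x, a, α)‖ ^ 2) ≤ (C_c' * δ) ^ 2 := by
      intro a α
      have h := hc L W m hm r hr hrL ε hε hεε₁ hsmallW x hprof' s hs0 htr a α
      have h' : Real.sqrt (∑ q, ‖(K s - K₁ s) q (x, a, α)‖ ^ 2) ≤ C_c' * δ := by
        simp only [Matrix.sub_apply]
        exact h.trans (mul_le_mul_of_nonneg_right (le_max_left _ _) hδ0.le)
      exact (Real.sqrt_le_left (by positivity)).mp h'
    calc ∑ a : Fin 3, ∑ α : Fin 4, (∑ q, ‖(K s - K₁ s) q (x, a, α)‖ ^ 2)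
        ≤ ∑ _a : Fin 3, ∑ _α : Fin 4, (C_c' * δ) ^ 2 :=
          Finset.sum_le_sum fun a _ => Finset.sum_le_sum fun α _ => hone a α
      _ = 12 * (C_c' * δ) ^ 2 := by
          simp only [Finset.sum_const, Finset.card_univ, Fintype.card_fin, nsmul_eq_mul, Nat.cast_ofNat]
          ring
  /- 4. pointwise bound of the summed `τ`-integrand: first order (hypothesis) + second order (Cauchy–Schwarz) -/
  set P : ℝ := δ ^ 2 * (C_B' + 12 * A₁ * C_D') / Real.sqrt (1 + s) with hP
  set Q : ℝ := 12 * (δ ^ 2 * A₁ * C_c') / (1 + s) with hQ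
  have hP0 : 0 ≤ P := by rw [hP]; positivity
  have hFle : ∀ τ ∈ Set.Icc (0:ℝ) s, ‖∑ a : Fin 3, ∑ α : Fin 4, f a α τ‖ ≤ P / Real.sqrt (1 + τ) + Q := by
    intro τ hτ
    obtain ⟨hτ0, hτs⟩ := hτ
    have hσ0 : 0 ≤ 2 * s - τ := by linarith
    have hσL : 2 * s - τ ≤ (L : ℝ) ^ 2 := by linarith
    have hτL : τ ≤ (L : ℝ) ^ 2 := by linarith
    have h1τ : 0 < 1 + τ := by linarith
    have hsσ : 1 + s ≤ 1 + (2 * s - τ) := by linarith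
    -- split `K(τ) = K₁(τ) + Δ(τ)` inside the sandwich
    have hfsplit : ∀ (a : Fin 3) (α : Fin 4), f a α τ =
        (K₁ (2 * s - τ) * (Dᴴ * D - D₁ᴴ * D₁) * K₁ τ) (x, a, α) (x, a, α) +
          (K₁ (2 * s - τ) * (Dᴴ * D - D₁ᴴ * D₁) * (K τ - K₁ τ)) (x, a, α) (x, a, α) := by
      intro a α
      rw [← Matrix.add_apply, ← mul_add, add_sub_cancel]
    simp only [hfsplit, Finset.sum_add_distrib]
    refine (norm_add_le _ _).trans ?_
    -- first order: hypothesis `FirstOrderTracedPairing` at `(σ, τ) = (2s − τ, τ)`, then `1 + 2s − τ ≥ 1 + s`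
    have hfirst : ‖∑ a : Fin 3, ∑ α : Fin 4,
        (K₁ (2 * s - τ) * (Dᴴ * D - D₁ᴴ * D₁) * K₁ τ) (x, a, α) (x, a, α)‖ ≤
        C_B' * δ ^ 2 / (Real.sqrt (1 + s) * Real.sqrt (1 + τ)) := by
      have h := hB L W m hm x δ hδ0.le hprof (2 * s - τ) τ hσ0 hσL hτ0 hτL
      refine h.trans ?_
      have hden : Real.sqrt (1 + s) * Real.sqrt (1 + τ) ≤ Real.sqrt ((1 + (2 * s - τ)) * (1 + τ)) := by
        rw [← Real.sqrt_mul hs1.le]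
        exact Real.sqrt_le_sqrt (mul_le_mul_of_nonneg_right hsσ h1τ.le)
      have hpos : 0 < Real.sqrt (1 + s) * Real.sqrt (1 + τ) := by positivity
      calc C_B * δ ^ 2 / Real.sqrt ((1 + (2 * s - τ)) * (1 + τ))
          ≤ C_B' * δ ^ 2 / Real.sqrt ((1 + (2 * s - τ)) * (1 + τ)) :=
            div_le_div_of_nonneg_right (mul_le_mul_of_nonneg_right (le_max_left _ _) (sq_nonneg _))
              (Real.sqrt_nonneg _)
        _ ≤ C_B' * δ ^ 2 / (Real.sqrt (1 + s) * Real.sqrt (1 + τ)) :=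
            div_le_div_of_nonneg_left (by positivity) hpos hden
    -- second order: `(K₁(σ)VΔ(τ))(p,p) = ⟨EᴴD₁K₁(σ)e_p, Δ(τ)e_p⟩ + ⟨EK₁(σ)e_p, DΔ(τ)e_p⟩`
    have hsecond : ∀ (a : Fin 3) (α : Fin 4),
        ‖(K₁ (2 * s - τ) * (Dᴴ * D - D₁ᴴ * D₁) * (K τ - K₁ τ)) (x, a, α) (x, a, α)‖ ≤
          δ * A₁ / (1 + s) * (C_c' * δ) + δ * A₁ / Real.sqrt (1 + s) * (C_D' * δ / Real.sqrt (1 + τ)) := by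
      intro a α
      obtain ⟨hE1, hE2⟩ := hE L W m hm x δ hδ0.le hprof (2 * s - τ) hσ0 hσL a α
      have hΔ : Real.sqrt (∑ q, ‖(K τ - K₁ τ) q (x, a, α)‖ ^ 2) ≤ C_c' * δ := by
        have h := hc L W m hm r hr hrL ε hε hεε₁ hsmallW x hprof' τ hτ0 (by linarith) a α
        simp only [Matrix.sub_apply]
        exact h.trans (mul_le_mul_of_nonneg_right (le_max_left _ _) hδ0.le)
      have hDΔ : Real.sqrt (∑ q, ‖(D * (K τ - K₁ τ)) q (x, a, α)‖ ^ 2) ≤ C_D' * δ / Real.sqrt (1 + τ) := by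
        have h := hDc L W m hm r hr hrL ε hε hεε₂ hsmallW x hprof' τ hτ0 (by linarith) a α
        exact h.trans (div_le_div_of_nonneg_right (mul_le_mul_of_nonneg_right (le_max_left _ _) hδ0.le)
          (Real.sqrt_nonneg _))
      refine (second_order_entry_bound D D₁ (K τ - K₁ τ) (2 * s - τ) (x, a, α)).trans (add_le_add ?_ ?_)
      · exact mul_le_mul (hE2.trans (div_le_div_of_nonneg_left (by positivity) hs1 hsσ)) hΔ
          (Real.sqrt_nonneg _) (by positivity)
      · exact mul_le_mul (hE1.trans (div_le_div_of_nonneg_left (by positivity) (Real.sqrt_pos.mpr hs1)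
          (Real.sqrt_le_sqrt hsσ))) hDΔ (Real.sqrt_nonneg _) (by positivity)
    refine (add_le_add hfirst (norm_sum_le_of_le _ fun a _ => norm_sum_le_of_le _ fun α _ => hsecond a α)).trans
      (le_of_eq ?_)
    simp only [Finset.sum_const, Finset.card_univ, Fintype.card_fin, nsmul_eq_mul, Nat.cast_ofNat, hP, hQ]
    ring
  have hPQ := norm_integral_le_of_inv_sqrt_bound (F := fun τ => ∑ a : Fin 3, ∑ α : Fin 4, f a α τ) hs0 hP0 hFle
  /- 5. assembly: `|Σ S_p − 2 Re ∫ F| ≤ 12 (C_c δ)² + 2 (2P√(1+s) + Q s) ≤ C δ²` -/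
  have hsq0 : 0 ≤ ∑ a : Fin 3, ∑ α : Fin 4, (∑ q, ‖(K s - K₁ s) q (x, a, α)‖ ^ 2) := by positivity
  have hmain : (∑ a : Fin 3, ∑ α : Fin 4, ((K (2 * s)) (x, a, α) (x, a, α)).re) -
      (∑ a : Fin 3, ∑ α : Fin 4, ((K₁ (2 * s)) (x, a, α) (x, a, α)).re) =
      (∑ a : Fin 3, ∑ α : Fin 4, (∑ q, ‖(K s - K₁ s) q (x, a, α)‖ ^ 2)) -
        2 * (∫ τ in (0:ℝ)..s, ∑ a : Fin 3, ∑ α : Fin 4, f a α τ).re := by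
    rw [← hexch, Finset.mul_sum, ← Finset.sum_sub_distrib, ← Finset.sum_sub_distrib]
    refine Finset.sum_congr rfl fun a _ => ?_
    rw [Finset.mul_sum, ← Finset.sum_sub_distrib, ← Finset.sum_sub_distrib]
    exact Finset.sum_congr rfl fun α _ => hsplit a α
  have hfinal : |(∑ a : Fin 3, ∑ α : Fin 4, ((K (2 * s)) (x, a, α) (x, a, α)).re) -
      (∑ a : Fin 3, ∑ α : Fin 4, ((K₁ (2 * s)) (x, a, α) (x, a, α)).re)| ≤
      (12 * C_c' ^ 2 + 2 * (2 * (C_B' + 12 * A₁ * C_D') + 12 * A₁ * C_c')) * δ ^ 2 := by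
    rw [hmain]
    refine (abs_sub _ _).trans ?_
    rw [abs_of_nonneg hsq0, abs_mul, abs_two]
    have hre : |(∫ τ in (0:ℝ)..s, ∑ a : Fin 3, ∑ α : Fin 4, f a α τ).re| ≤ 2 * P * Real.sqrt (1 + s) + Q * s :=
      (Complex.abs_re_le_norm _).trans hPQ
    have hPs : 2 * P * Real.sqrt (1 + s) = 2 * (δ ^ 2 * (C_B' + 12 * A₁ * C_D')) := by
      have hsq1 : Real.sqrt (1 + s) ≠ 0 := (Real.sqrt_pos.mpr hs1).ne'
      rw [hP]
      field_simp
    have hQs : Q * s ≤ 12 * (δ ^ 2 * A₁ * C_c') := by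
      rw [hQ, div_mul_eq_mul_div, div_le_iff₀ hs1]
      exact mul_le_mul_of_nonneg_left (by linarith) (by positivity)
    nlinarith [hsq, hre, hPs, hQs]
  exact hfinal

end Summit.QuantumFields.QCD.Cruxes.TracedQuadraticParametrix.Sketch

end
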